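import Literature.MathematicalPhysics.QuantumFieldTheory.Balaban1983to89.B7Eq47AveragedBondVsStraight
import Literature.MathematicalPhysics.QuantumFieldTheory.Balaban1983to89.B8Lemma1NonAbelian
import HarnessLib

/-!
# `UnitScaleTiltProp7CornerFrameLegsCurvature` — LANE II (R-LEGS), brick (K1): THE THREE CURVATURE LETTERS `δ₀ δ δ₁` OF THE LEGS STEP, DISCHARGED BY THE AXIAL GAUGE AT THE BLOCK CORNER
# — for a `U1`-valued `ℤᵈ` background `V` with every plaquette variable within `a` of `1` and `T := rescale L (bavg L V)` (the next comb average, [Balaban1985Averaging] (42)∕(43)):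
# `δ₀ ≤ 64(d+1)(d+4)L²·a`, `δ ≤ 2L·a` (thin `L×1` rectangles), `δ₁ ≤ (2dL² + 64(d+1)(d+4)L²)·a` (box rectangles) (crux `MinimiserStabilityRegPr`, stmt-QuantumFields-19200, EX lane, hN06 LANE II
# (QB)∕(QH1) supplier (R-LEGS); `--supports stmt-QuantumFields-19200 --as helper`, count-neutral)

Cell `ym3-torus` (HUMAN RULING D-0037: YM₃ on T³ is ladder rung R3 — NOT d = 4, NOT infinite volume, NOT a mass gap, NOT the Clay problem), width seat `ym-ust-20520-w4` (g12), pen of the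
curved row `rlegs`.  THEOREMS ONLY (0 `def`, 0 `sorry`); nothing here claims (R-LEGS-cov), (QB), (QH1), (REC), `hN06`, EX or the crux.

WHY.  ✓(Br-5′) `Prop7CornerFrameLegsStepCell.legs_step_cell_le` displays three curvature letters of the level-`l` transporter field `V` (at the member: the comb tower `Ūˡ = avgIter L W♯ l`) and the
next-level transporters `T` (member: `Ūˡ⁺¹ = rescale L (bavg L Ūˡ)`, lit ✓`avgIter_succ`): `δ₀ ≥ ‖V(L•z; L steps e_μ) − T(z,μ)‖`, `δ ≥ ‖V(y,κ)·V(y+e_κ; L e_μ) − V(y; L e_μ)·V(y + L•e_μ, κ)‖`,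
`δ₁ ≥ ‖V(L•z; Γ_r)·V(L•z + r; L e_μ) − T(z,μ)·V(L•(z+e_μ); Γ_r)‖`.  All three are differences of transports along two paths with the same end points; in the AXIAL (tree) gauge based at the
path's origin (lit ✓`B7Prop1Explicit.hol_gaugeAct`∕`axialFn`, [Balaban1985Averaging] p.24) such a difference is at most the sum of the two `‖V₀(path) − 1‖`, and those are the printed «area
counts»: lit ✓`B8Lemma1NonAbelian.hol_axial_treeWord`∕`hol_axial_seg_base` (tree pieces `= 1`), ✓`norm_axial_seg_sub_one_le` (`[y+r, y+r+Le_μ]`: `≤ L·‖r_{<μ}‖₁·a`), ✓`norm_axial_tree_sub_one_le`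
(the neighbour's tree: `≤ Σ_{κ'>μ} r_{κ'}·L·a`), and lit ✓`B7Eq47AveragedBondVsStraight.norm_bavg_sub_straight_le_of_pdev` (`‖V̄(c) − V(c)‖ ≤ 64(d+1)(d+4)L²a`).

* §1 `norm_hol_sub_hol_le_axial` — two paths from `x` with the same displacement: `‖V(w₁) − V(w₂)‖ ≤ ‖V₀(w₁) − 1‖ + ‖V₀(w₂) − 1‖` in the axial gauge at `x`.
* §2 `l1_lowPart_zsmul_e_le`, ★`thinRect_le` (`δ ≤ 2L·a`), ★`straight_sub_bavg_le` (`δ₀`), ★★`boxRect_le` (`δ₁`) — the three letters for `T := rescale L (bavg L V)`, under the global plaquette bound `h44` and the [B7] Prop. 2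
  window `512(d+1)(d+4)L²a ≤ 1`.
HONEST SCOPE.  Bookkeeping over lit-balaban's axial-gauge estimates; rung R3; nothing of the crux ∕ the gap is claimed.

References: T. Bałaban, CMP 98 (1985) 17–51 [Balaban1985Averaging] ((9) p.18, (42)–(44) pp.23–24, p.24 (tree gauge), p.25, (47) p.25); CMP 99 (1985) 75–102 [Balaban1985RegularSpaces]
((1.7) p.77, p.79).
-/

set_option autoImplicit false

noncomputable section

open scoped BigOperators

namespace Summit.QuantumFields.YangMills.Theorems.Prop7CornerFrameLegsCurvature

open Finset NormedSpace
open Literature.MathematicalPhysics.QuantumFieldTheory.Balaban1983to89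
open B7Prop1Explicit (Site Letter e hol hol_cons hol_nil hol_append stepHol U1 mem_U1 hol_mem treeWord boxVec seg seg_natCast disp disp_seg disp_treeWord disp_append disp_cons
  gaugeAct axialFn hol_gaugeAct axialFn_mem gaugeAct_mem hol_axial_treeWord bavg plaqWord l1 length_treeWord l1_boxVec_le)
open B7Prop2Explicit (rescale rescale_apply)
open B8Lemma1NonAbelian (hol_axial_seg_base norm_axial_seg_sub_one_le norm_axial_tree_sub_one_le lowPart l1_lowPart_boxVec_le boxVec_nonneg zsmul_e_nonneg)
open B7Eq47AveragedBondVsStraight (norm_bavg_sub_straight_le_of_pdev)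

variable {d : ℕ} {𝔸 : Type*} [NormedRing 𝔸] [NormOneClass 𝔸] [NormedAlgebra ℂ 𝔸] [CompleteSpace 𝔸]

/-! ## §1 Two paths with the same end points, read in the axial gauge at their origin -/

omit [NormedAlgebra ℂ 𝔸] [CompleteSpace 𝔸] in
/-- **TWO PATHS, ONE DISPLACEMENT**: for a `U1`-valued `V` and words `w₁ w₂` from `x` with `disp w₁ = disp w₂`, `‖V(x; w₁) − V(x; w₂)‖ ≤ ‖V₀(x; w₁) − 1‖ + ‖V₀(x; w₂) − 1‖` where
`V₀ = V^{v₀}` is the axial gauge at `x` (both holonomies are `v₀(x)⁻¹·V₀(·)·v₀(x + disp)`, lit ✓`hol_gaugeAct`; the gauge factors are in `U1`). [cite: Balaban1985Averaging, (9) p.18, p.24] -/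
theorem norm_hol_sub_hol_le_axial {V : Site d → Fin d → 𝔸ˣ} (hV : ∀ x κ, V x κ ∈ U1 𝔸) (x : Site d) {w₁ w₂ : List (Letter d)} (hdisp : disp w₁ = disp w₂) :
    ‖((hol V x w₁ : 𝔸ˣ) : 𝔸) - ((hol V x w₂ : 𝔸ˣ) : 𝔸)‖
      ≤ ‖((hol (gaugeAct (axialFn V x) V) x w₁ : 𝔸ˣ) : 𝔸) - 1‖ + ‖((hol (gaugeAct (axialFn V x) V) x w₂ : 𝔸ˣ) : 𝔸) - 1‖ := by
  set u := axialFn V x with hu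
  have huU : ∀ y, u y ∈ U1 𝔸 := fun y => axialFn_mem hV x y
  -- `V(w) = u(x)⁻¹ · V₀(w) · u(x + disp w)`
  have hid : ∀ w : List (Letter d), hol V x w = (u x)⁻¹ * hol (gaugeAct u V) x w * u (x + disp w) := by
    intro w; rw [hol_gaugeAct]; group
  rw [hid w₁, hid w₂, hdisp]
  set A := hol (gaugeAct u V) x w₁
  set B := hol (gaugeAct u V) x w₂
  set p := u (x + disp w₂)
  obtain ⟨_, hux2⟩ := mem_U1.1 (huU x)
  obtain ⟨hp1, _⟩ := mem_U1.1 (huU (x + disp w₂))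
  have e : (((u x)⁻¹ * A * p : 𝔸ˣ) : 𝔸) - (((u x)⁻¹ * B * p : 𝔸ˣ) : 𝔸)
      = (((u x)⁻¹ : 𝔸ˣ) : 𝔸) * (((A : 𝔸ˣ) : 𝔸) - 1 - (((B : 𝔸ˣ) : 𝔸) - 1)) * (p : 𝔸) := by
    push_cast; noncomm_ring
  rw [e]
  calc _ ≤ ‖(((u x)⁻¹ : 𝔸ˣ) : 𝔸)‖ * ‖((A : 𝔸ˣ) : 𝔸) - 1 - (((B : 𝔸ˣ) : 𝔸) - 1)‖ * ‖(p : 𝔸)‖ :=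
        (norm_mul_le _ _).trans (mul_le_mul_of_nonneg_right (norm_mul_le _ _) (norm_nonneg _))
    _ ≤ 1 * ‖((A : 𝔸ˣ) : 𝔸) - 1 - (((B : 𝔸ˣ) : 𝔸) - 1)‖ * 1 := by gcongr
    _ ≤ _ := by rw [one_mul, mul_one]; exact norm_sub_le _ _

/-- `‖lowPart μ (n•e_κ)‖₁ ≤ |n|` (it is `n•e_κ` or `0`). [folklore] -/
theorem l1_lowPart_zsmul_e_le (μ κ : Fin d) (n : ℤ) : l1 (lowPart μ (n • e κ : Site d)) ≤ n.natAbs := by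
  by_cases h : κ < μ
  · rw [B8Lemma1NonAbelian.lowPart_zsmul_e_of_lt h, B7Prop1Explicit.l1_zsmul_e]
  · rw [B8Lemma1NonAbelian.lowPart_zsmul_e_of_le (not_lt.mp h)]
    simp [l1]

/-! ## §2 The three letters for the comb step `T := rescale L (bavg L V)` -/

section Letters

variable (L : ℕ) {V : Site d → Fin d → 𝔸ˣ} (hV : ∀ x κ, V x κ ∈ U1 𝔸) {a : ℝ} (ha : 0 ≤ a)
  (h44 : ∀ (x : Site d) (κ κ' : Fin d), κ ≠ κ' → ‖((hol V x (plaqWord κ κ') : 𝔸ˣ) : 𝔸) - 1‖ ≤ a)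

omit [NormOneClass 𝔸] [NormedAlgebra ℂ 𝔸] [CompleteSpace 𝔸] in
include h44 in
/-- the global plaquette bound as lit's box-local `PlaqSmall` on every box. [cite: Balaban1985RegularSpaces, (1.7) p.77] -/
theorem plaqSmall_of_h44 (lo hi : Site d) : B8Lemma1NonAbelian.PlaqSmall V lo hi a :=
  fun x κ μ hκμ _ _ => h44 x κ μ hκμ

omit [NormedAlgebra ℂ 𝔸] [CompleteSpace 𝔸] in
include hV ha h44 in
/-- ★ **THE THIN RECTANGLE `δ ≤ 2L·a`**: `‖V(y,κ)·V(y + e_κ; L e_μ) − V(y; L e_μ)·V(y + L•e_μ, κ)‖ ≤ 2L·a` — two paths `y → y + e_κ + L•e_μ`; in the axial gauge at `y` the first is `1·[segment off the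
tree by at most one unit in direction κ < μ]` (`≤ L·a`, lit ✓`norm_axial_seg_sub_one_le`), the second `[tree segment = 1]·[bond κ at y + Le_μ]` (`≤ L·a` iff `μ < κ`, else `0`, lit ✓`axial_bond_bound_sharp`).
[cite: Balaban1985Averaging, p.24, p.25; Balaban1985RegularSpaces, p.79] -/
theorem thinRect_le (y : Site d) (κ μ : Fin d) :
    ‖(V y κ : 𝔸) * ((hol V (y + e κ) (List.replicate L (μ, true)) : 𝔸ˣ) : 𝔸)
        - ((hol V y (List.replicate L (μ, true)) : 𝔸ˣ) : 𝔸) * (V (y + (L : ℤ) • e μ) κ : 𝔸)‖ ≤ 2 * (L : ℝ) * a := by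
  -- the two words
  have hw1 : hol V y ((κ, true) :: List.replicate L (μ, true)) = V y κ * hol V (y + e κ) (List.replicate L (μ, true)) := by
    rw [hol_cons]; rfl
  have hw2 : hol V y (List.replicate L (μ, true) ++ [(κ, true)]) = hol V y (List.replicate L (μ, true)) * V (y + (L : ℤ) • e μ) κ := by
    rw [hol_append, ← seg_natCast, disp_seg, seg_natCast, hol_cons, hol_nil, mul_one]; rfl
  have hdisp : disp ((κ, true) :: List.replicate L (μ, true)) = disp (List.replicate L (μ, true) ++ [(κ, true)]) := by
    rw [disp_cons, disp_append, disp_cons, ← seg_natCast, disp_seg]; simp [disp]; abel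
  have h := norm_hol_sub_hol_le_axial hV y hdisp
  rw [hw1, hw2, Units.val_mul, Units.val_mul] at h
  refine h.trans ?_
  -- the two axial-gauge bounds
  set V₀ := gaugeAct (axialFn V y) V with hV₀
  have hP := plaqSmall_of_h44 (V := V) h44
  -- path 1: `V₀(y,κ)·V₀(y+e_κ; seg μ L)`, `V₀(y,κ) = 1` (tree bond from the base), segment `≤ L·‖lowPart μ e_κ‖₁·a ≤ L·a`
  have h1a : hol V₀ y (seg κ (1 : ℕ)) = 1 := by rw [hV₀]; exact_mod_cast hol_axial_seg_base V y κ 1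
  have h1a' : V₀ y κ = 1 := by
    have : hol V₀ y (seg κ (1 : ℕ)) = V₀ y κ := by
      rw [seg_natCast, List.replicate_one, hol_cons, hol_nil, mul_one]; rfl
    rw [← this, h1a]
  have h1b : ‖((hol V₀ (y + e κ) (seg μ L) : 𝔸ˣ) : 𝔸) - 1‖ ≤ L * (l1 (lowPart μ (e κ)) * a) :=
    norm_axial_seg_sub_one_le V hV (hP (y) (y + e κ + (L : ℤ) • e μ)) y (e κ) (B8Lemma1NonAbelian.e_nonneg κ) μ L le_rfl le_rfl
  have hl1 : l1 (lowPart μ (e κ : Site d)) ≤ 1 := by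
    have h := l1_lowPart_zsmul_e_le μ κ 1
    rwa [one_zsmul] at h
  have hp1 : ‖((hol V₀ y ((κ, true) :: List.replicate L (μ, true)) : 𝔸ˣ) : 𝔸) - 1‖ ≤ (L : ℝ) * a := by
    rw [hol_cons, show stepHol V₀ y (κ, true) = V₀ y κ from rfl, h1a', one_mul, show Letter.vec ((κ, true) : Letter d) = e κ from rfl, ← seg_natCast]
    refine h1b.trans ?_
    have : (L : ℝ) * (l1 (lowPart μ (e κ : Site d)) * a) ≤ (L : ℝ) * (1 * a) := by
      refine mul_le_mul_of_nonneg_left (mul_le_mul_of_nonneg_right (by exact_mod_cast hl1) ha) (Nat.cast_nonneg _)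
    linarith
  -- path 2: `V₀(y; seg μ L)·V₀(y + Le_μ, κ)`, first factor `= 1`, bond `≤ ‖lowPart κ (L•e_μ)‖₁·a ≤ L·a`
  have h2a : hol V₀ y (seg μ L) = 1 := by rw [hV₀]; exact_mod_cast hol_axial_seg_base V y μ L
  have h2b : ‖((V₀ (y + (L : ℤ) • e μ) κ : 𝔸ˣ) : 𝔸) - 1‖ ≤ l1 (lowPart κ ((L : ℤ) • e μ)) * a := by
    have h := B8Lemma1NonAbelian.axial_bond_bound_sharp V hV (hP y (y + (L : ℤ) • e μ + e κ)) y (y + (L : ℤ) • e μ) κ le_rfl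
      (le_add_of_nonneg_right (zsmul_e_nonneg (by positivity) μ)) le_rfl
    rwa [show y + (L : ℤ) • e μ - y = (L : ℤ) • e μ by abel] at h
  have hl2 : l1 (lowPart κ ((L : ℤ) • e μ : Site d)) ≤ L := by
    have h := l1_lowPart_zsmul_e_le κ μ (L : ℤ)
    rwa [Int.natAbs_natCast] at h
  have hp2 : ‖((hol V₀ y (List.replicate L (μ, true) ++ [(κ, true)]) : 𝔸ˣ) : 𝔸) - 1‖ ≤ (L : ℝ) * a := by
    rw [hol_append, ← seg_natCast, disp_seg, h2a, one_mul, hol_cons, hol_nil, mul_one, show stepHol V₀ (y + (L : ℤ) • e μ) (κ, true) = V₀ (y + (L : ℤ) • e μ) κ from rfl]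
    refine h2b.trans ?_
    exact mul_le_mul_of_nonneg_right (by exact_mod_cast hl2) ha
  linarith

include hV ha h44 in
/-- ★ **THE STRAIGHT TRANSPORT VERSUS THE NEXT COMB BOND `δ₀ ≤ 64(d+1)(d+4)L²·a`**: `‖V(L•z; L steps e_μ) − (rescale L (bavg L V)) z μ‖ ≤ 64(d+1)(d+4)L²a` in the [B7] Prop. 2 window
`512(d+1)(d+4)L²a ≤ 1` — lit ✓`norm_bavg_sub_straight_le_of_pdev` (the loop variables of (42) bound `O(L²)` plaquettes). [cite: Balaban1985Averaging, (42) p.23, (44) p.24, p.25] -/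
theorem straight_sub_bavg_le (hL : 1 ≤ L) (hsmall : 512 * (d + 1) * (d + 4) * (L : ℝ) ^ 2 * a ≤ 1) (z : Site d) (μ : Fin d) :
    ‖((hol V ((L : ℤ) • z) (List.replicate L (μ, true)) : 𝔸ˣ) : 𝔸) - ((rescale L (bavg L V) z μ : 𝔸ˣ) : 𝔸)‖ ≤ 64 * (d + 1) * (d + 4) * (L : ℝ) ^ 2 * a := by
  rw [rescale_apply, norm_sub_rev, ← seg_natCast]
  exact norm_bavg_sub_straight_le_of_pdev L hL hV ha hsmall h44 _ μ

include hV ha h44 in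
/-- ★★ **THE BOX RECTANGLE `δ₁ ≤ (2dL² + 64(d+1)(d+4)L²)·a`**: `‖V(L•z; Γ_r)·V(L•z + r; L e_μ) − (rescale L (bavg L V)) z μ · V(L•(z + e_μ); Γ_r)‖` — the comb bond is the straight transport up to `δ₀`, and the two
paths `Γ_r ∪ [L•z + r, + L e_μ]`, `[L•z, + L e_μ] ∪ (Γ_r + L e_μ)` from the corner read in its axial gauge: tree pieces `= 1` (lit ✓`hol_axial_treeWord`∕`hol_axial_seg_base`), the offset segment
`≤ L·‖r_{<μ}‖₁·a ≤ dL²·a` (✓`norm_axial_seg_sub_one_le`), the neighbour's tree `≤ Σ_{κ'>μ} r_{κ'}·L·a ≤ dL²·a` (✓`norm_axial_tree_sub_one_le`).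
[cite: Balaban1985Averaging, p.24, p.25, (42)-(44) pp.23-24; Balaban1985RegularSpaces, p.79] -/
theorem boxRect_le (hL : 1 ≤ L) (hsmall : 512 * (d + 1) * (d + 4) * (L : ℝ) ^ 2 * a ≤ 1) (z : Site d) (μ : Fin d) (r : Fin d → Fin L) :
    ‖((hol V ((L : ℤ) • z) (treeWord (boxVec L r)) : 𝔸ˣ) : 𝔸) * ((hol V ((L : ℤ) • z + boxVec L r) (List.replicate L (μ, true)) : 𝔸ˣ) : 𝔸)
        - ((rescale L (bavg L V) z μ : 𝔸ˣ) : 𝔸) * ((hol V ((L : ℤ) • (z + e μ)) (treeWord (boxVec L r)) : 𝔸ˣ) : 𝔸)‖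
      ≤ (2 * d * (L : ℝ) ^ 2 + 64 * (d + 1) * (d + 4) * (L : ℝ) ^ 2) * a := by
  set y : Site d := (L : ℤ) • z with hy
  have hyμ : (L : ℤ) • (z + e μ) = y + (L : ℤ) • e μ := by rw [hy, smul_add]
  rw [hyμ]
  have hLr : (1 : ℝ) ≤ L := by exact_mod_cast hL
  have hdr : (0 : ℝ) ≤ d := Nat.cast_nonneg _
  have hr0 : (0 : Site d) ≤ boxVec L r := boxVec_nonneg L r
  have hP := plaqSmall_of_h44 (V := V) h44
  -- (i) comb bond versus straight
  have hδ₀ := straight_sub_bavg_le L hV ha h44 hL hsmall z μ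
  rw [← hy] at hδ₀
  -- (ii) the two paths from `y`
  have hwA : hol V y (treeWord (boxVec L r) ++ List.replicate L (μ, true)) = hol V y (treeWord (boxVec L r)) * hol V (y + boxVec L r) (List.replicate L (μ, true)) := by
    rw [hol_append, disp_treeWord]
  have hwB : hol V y (List.replicate L (μ, true) ++ treeWord (boxVec L r)) = hol V y (List.replicate L (μ, true)) * hol V (y + (L : ℤ) • e μ) (treeWord (boxVec L r)) := by
    rw [hol_append, ← seg_natCast, disp_seg]
  have hdisp : disp (treeWord (boxVec L r) ++ List.replicate L (μ, true)) = disp (List.replicate L (μ, true) ++ treeWord (boxVec L r)) := by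
    rw [disp_append, disp_append, disp_treeWord, ← seg_natCast, disp_seg]; abel
  have hpaths := norm_hol_sub_hol_le_axial hV y hdisp
  rw [hwA, hwB, Units.val_mul, Units.val_mul] at hpaths
  set V₀ := gaugeAct (axialFn V y) V with hV₀
  -- path A in the axial gauge: `1 · [offset segment]`
  have hA : ‖((hol V₀ y (treeWord (boxVec L r) ++ List.replicate L (μ, true)) : 𝔸ˣ) : 𝔸) - 1‖ ≤ d * (L : ℝ) ^ 2 * a := by
    rw [hol_append, disp_treeWord, hV₀, hol_axial_treeWord, one_mul, ← seg_natCast]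
    have h := norm_axial_seg_sub_one_le V hV (hP y (y + boxVec L r + (L : ℤ) • e μ)) y (boxVec L r) hr0 μ L le_rfl le_rfl
    refine h.trans ?_
    have hl := l1_lowPart_boxVec_le (d := d) μ r
    have hl' : (l1 (lowPart μ (boxVec L r)) : ℝ) ≤ d * L := by nlinarith
    calc (L : ℝ) * ((l1 (lowPart μ (boxVec L r)) : ℝ) * a) ≤ (L : ℝ) * ((d * L : ℝ) * a) := by gcongr
      _ = d * (L : ℝ) ^ 2 * a := by ring
  -- path B in the axial gauge: `1 · [the neighbour's tree]`
  have hB : ‖((hol V₀ y (List.replicate L (μ, true) ++ treeWord (boxVec L r)) : 𝔸ˣ) : 𝔸) - 1‖ ≤ d * (L : ℝ) ^ 2 * a := by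
    rw [hol_append, ← seg_natCast, disp_seg, hV₀, hol_axial_seg_base, one_mul]
    have h := norm_axial_tree_sub_one_le V hV (hP y (y + (L : ℤ) • e μ + boxVec L r)) y μ L (boxVec L r) hr0 le_rfl le_rfl
    refine h.trans ?_
    have hterm : ∀ κ' : Fin d, (((boxVec L r κ').natAbs : ℕ) : ℝ) * (if μ < κ' then (L : ℝ) * a else 0) ≤ (L : ℝ) * ((L : ℝ) * a) := by
      intro κ'
      have hrk : (((boxVec L r κ').natAbs : ℕ) : ℝ) ≤ L := by
        have : (boxVec L r κ').natAbs = (r κ' : ℕ) := by simp [boxVec]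
        rw [this]; exact_mod_cast (r κ').isLt.le
      split_ifs
      · exact mul_le_mul hrk le_rfl (by positivity) (by positivity)
      · rw [mul_zero]; positivity
    calc ∑ κ' : Fin d, (((boxVec L r κ').natAbs : ℕ) : ℝ) * (if μ < κ' then (L : ℝ) * a else 0)
        ≤ ∑ _κ' : Fin d, (L : ℝ) * ((L : ℝ) * a) := Finset.sum_le_sum fun κ' _ => hterm κ'
      _ = d * (L : ℝ) ^ 2 * a := by rw [Finset.sum_const, Finset.card_univ, Fintype.card_fin, nsmul_eq_mul]; ring
  -- (iii) assemble: swap the comb bond for the straight transport at cost `δ₀ · 1`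
  have hΓ1 : ‖((hol V (y + (L : ℤ) • e μ) (treeWord (boxVec L r)) : 𝔸ˣ) : 𝔸)‖ ≤ 1 := (mem_U1.1 (hol_mem hV _ _)).1
  have hsplit : ((hol V y (treeWord (boxVec L r)) : 𝔸ˣ) : 𝔸) * ((hol V (y + boxVec L r) (List.replicate L (μ, true)) : 𝔸ˣ) : 𝔸)
        - ((rescale L (bavg L V) z μ : 𝔸ˣ) : 𝔸) * ((hol V (y + (L : ℤ) • e μ) (treeWord (boxVec L r)) : 𝔸ˣ) : 𝔸)
      = (((hol V y (treeWord (boxVec L r)) : 𝔸ˣ) : 𝔸) * ((hol V (y + boxVec L r) (List.replicate L (μ, true)) : 𝔸ˣ) : 𝔸)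
          - ((hol V y (List.replicate L (μ, true)) : 𝔸ˣ) : 𝔸) * ((hol V (y + (L : ℤ) • e μ) (treeWord (boxVec L r)) : 𝔸ˣ) : 𝔸))
        + (((hol V y (List.replicate L (μ, true)) : 𝔸ˣ) : 𝔸) - ((rescale L (bavg L V) z μ : 𝔸ˣ) : 𝔸)) * ((hol V (y + (L : ℤ) • e μ) (treeWord (boxVec L r)) : 𝔸ˣ) : 𝔸) := by
    noncomm_ring
  rw [hsplit]
  have hsecond : ‖(((hol V y (List.replicate L (μ, true)) : 𝔸ˣ) : 𝔸) - ((rescale L (bavg L V) z μ : 𝔸ˣ) : 𝔸)) * ((hol V (y + (L : ℤ) • e μ) (treeWord (boxVec L r)) : 𝔸ˣ) : 𝔸)‖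
      ≤ 64 * (d + 1) * (d + 4) * (L : ℝ) ^ 2 * a := by
    refine (norm_mul_le _ _).trans ?_
    have h0 : 0 ≤ 64 * (d + 1) * (d + 4) * (L : ℝ) ^ 2 * a := by positivity
    nlinarith [hδ₀, hΓ1, norm_nonneg (((hol V y (List.replicate L (μ, true)) : 𝔸ˣ) : 𝔸) - ((rescale L (bavg L V) z μ : 𝔸ˣ) : 𝔸)),
      norm_nonneg (((hol V (y + (L : ℤ) • e μ) (treeWord (boxVec L r)) : 𝔸ˣ) : 𝔸))]
  calc _ ≤ ‖((hol V y (treeWord (boxVec L r)) : 𝔸ˣ) : 𝔸) * ((hol V (y + boxVec L r) (List.replicate L (μ, true)) : 𝔸ˣ) : 𝔸)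
          - ((hol V y (List.replicate L (μ, true)) : 𝔸ˣ) : 𝔸) * ((hol V (y + (L : ℤ) • e μ) (treeWord (boxVec L r)) : 𝔸ˣ) : 𝔸)‖
        + ‖(((hol V y (List.replicate L (μ, true)) : 𝔸ˣ) : 𝔸) - ((rescale L (bavg L V) z μ : 𝔸ˣ) : 𝔸)) * ((hol V (y + (L : ℤ) • e μ) (treeWord (boxVec L r)) : 𝔸ˣ) : 𝔸)‖ :=
        norm_add_le _ _
    _ ≤ (d * (L : ℝ) ^ 2 * a + d * (L : ℝ) ^ 2 * a) + 64 * (d + 1) * (d + 4) * (L : ℝ) ^ 2 * a := by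
        linarith [hpaths.trans (add_le_add hA hB), hsecond]
    _ = _ := by ring

end Letters

end Summit.QuantumFields.YangMills.Theorems.Prop7CornerFrameLegsCurvature

end
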